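import Summits.AtomisticToContinuum.HydrodynamicLimit.Theses.OneFlightGossipEngine
import Summits.AtomisticToContinuum.HydrodynamicLimit.Theorems.AprioriBounds.Negative.FlowInvariance
import Literature.Analysis.FluidPDE.HardSphereUniqueness
import Literature.MathematicalPhysics.KineticTheory.HardSphereEulerProofs

/-!
# `EnergyCurrentTails` (stmt-AtomisticToContinuum-9235) at GLOBAL EQUILIBRIUM — candidate proof of the
equilibrium rung (POSITIVE special case; evidence only, written by the standing disprover
refuter-cdisprove-stmt-AtomisticToContinuum-9235-0 to certify that the crux is consistent in the one
regime where its horizon `T` is unbounded).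

For the homogeneous profile `a₀ = 1`, `u₀ = 0`, `θ₀ = θ̄ > 0`, every `0 < σ < 1/2`, EVERY family of
hard-sphere flows `Φ`, every `ε > 0`: there is a cut-off `M` with
`E_{λ_N} (N+1)⁻¹ ∑ᵢ 𝟙{M < |vᵢ(s)|}|vᵢ(s)|³ ≤ ε` for ALL `N` and ALL times `s ∈ ℝ`
(`energyCurrentTails_homogeneous`, any constant activity `a > 0` in `energyCurrentTails_homogeneous'`,
and the crux's body verbatim at this profile in `energyCurrentTails_body_homogeneous`; no `N₀`, no
horizon).  Ingredients: a.e. uniqueness of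
hard-sphere flows (`HardSphereFlow.flow_eq_ae_holds`) to pass to the regularised Alexander flow;
invariance of the homogeneous local Gibbs law under it
(`AprioriBoundsNegative.measurePreserving_regFlow_localGibbsMeasure`); the disintegration
`lintegral_localGibbsMeasure` (each velocity is `N(0, θ̄ I₃)` given the positions), which makes the
expected empirical cubic tail EXACTLY the one-body Gaussian cubic tail `T(M)`, independent of `N`
and `s`; and `T(M) ≤ M⁻¹ E|w|⁴ → 0`.
-/

noncomputable section

open MeasureTheory Filter Set Topology
open scoped ENNReal

namespace Summit.AtomisticToContinuum.HydrodynamicLimit.Cruxes.EnergyCurrentTails.Equilibrium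

open Literature.MathematicalPhysics.KineticTheory Literature.Analysis.FluidPDE
open Summit.AtomisticToContinuum.HydrodynamicLimit.Theorems.AprioriBoundsNegative

/-- One-particle cubic tail `𝟙{M < |v|} |v|³`. -/
def tail3 (M : ℝ) (v : V3) : ℝ := Set.indicator {v : V3 | M < ‖v‖} (fun v => ‖v‖ ^ 3) v

/-- The crux's empirical cubic tail. -/
def cubicTail (N : ℕ) (M : ℝ) (z : Config (N + 1) (Fin 3) T3) : ℝ :=
  ((N : ℝ) + 1)⁻¹ * ∑ i : Fin (N + 1), tail3 M (z i).2

theorem tail3_nonneg (M : ℝ) (v : V3) : 0 ≤ tail3 M v :=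
  Set.indicator_nonneg (fun w _ => by positivity) v

theorem measurable_tail3 (M : ℝ) : Measurable (tail3 M) := by
  unfold tail3
  exact (measurable_norm.pow_const 3).indicator (measurableSet_lt measurable_const measurable_norm)

theorem measurable_cubicTail (N : ℕ) (M : ℝ) : Measurable (cubicTail N M) := by
  unfold cubicTail
  refine Measurable.const_mul (Finset.measurable_sum _ fun i _ => ?_) _
  exact (measurable_tail3 M).comp (measurable_snd.comp (measurable_pi_apply i))

/-- The one-body Gaussian cubic tail `T(M) = ∫ 𝟙{M<|w|}|w|³ N(0, θ̄ I₃)(dw)`. -/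
def gaussTail (θb M : ℝ) : ℝ≥0∞ := ∫⁻ w, ENNReal.ofReal (tail3 M w) ∂(gaussMeasure (0 : V3) θb)

/-- **Invariance**: under the homogeneous local Gibbs law, composing with ANY hard-sphere flow does
not change expectations. -/
theorem lintegral_comp_flow_eq {σ : ℝ} (hσ : 0 < σ) (hσ2 : σ < 1 / 2) (θb : ℝ) (N : ℕ)
    (Φ : HardSphereFlow (Torus.geometry (Fin 3)) (hsDiameter σ N) (N + 1)) (s : ℝ)
    {F : Config (N + 1) (Fin 3) T3 → ℝ≥0∞} (hF : Measurable F) :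
    ∫⁻ z, F (Φ.flow s z) ∂(localGibbsMeasure σ (fun _ => 1) (fun _ => 0) (fun _ => θb) N) =
      ∫⁻ z, F z ∂(localGibbsMeasure σ (fun _ => 1) (fun _ => 0) (fun _ => θb) N) := by
  have hε : 0 < hsDiameter σ N := hsDiameter_pos hσ N
  have hε' : hsDiameter σ N < 2⁻¹ := (hsDiameter_le hσ.le N).trans_lt (by linarith)
  set Ψ := Alexander.regHardSphereFlow (d := Fin 3) hε hε' (N + 1) with hΨ
  have hae : Φ.flow s =ᵐ[liouville (Torus.geometry (Fin 3)) (N + 1) (hsDiameter σ N)] Ψ.flow s :=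
    HardSphereFlow.flow_eq_ae_holds Φ Ψ s
  have hae' : Φ.flow s =ᵐ[localGibbsMeasure σ (fun _ => 1) (fun _ => 0) (fun _ => θb) N] Ψ.flow s :=
    (localGibbsMeasure_absolutelyContinuous σ _ _ _ N Φ).ae_le hae
  calc ∫⁻ z, F (Φ.flow s z) ∂(localGibbsMeasure σ (fun _ => 1) (fun _ => 0) (fun _ => θb) N)
      = ∫⁻ z, F (Ψ.flow s z) ∂(localGibbsMeasure σ (fun _ => 1) (fun _ => 0) (fun _ => θb) N) :=
        lintegral_congr_ae (hae'.mono fun z hz => by simp only [hz])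
    _ = ∫⁻ z, F z ∂(localGibbsMeasure σ (fun _ => 1) (fun _ => 0) (fun _ => θb) N) :=
        (measurePreserving_regFlow_localGibbsMeasure hσ hσ2 θb N s).lintegral_comp hF

/-- **Static computation**: the expected empirical cubic tail under the homogeneous local Gibbs law
is exactly the one-body Gaussian cubic tail, for every `N` (`σ ≤ 1/2`). -/
theorem lintegral_cubicTail_eq_gaussTail {σ : ℝ} (hσ2 : σ ≤ 1 / 2) {θb : ℝ} (hθ : 0 < θb)
    (N : ℕ) (M : ℝ) :
    ∫⁻ z, ENNReal.ofReal (cubicTail N M z) ∂(localGibbsMeasure σ (fun _ => 1) (fun _ => 0) (fun _ => θb) N) =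
      gaussTail θb M := by
  have ha : Continuous fun _ : T3 => (1 : ℝ) := continuous_const
  have hu : Continuous fun _ : T3 => (0 : V3) := continuous_const
  have hθc : Continuous fun _ : T3 => θb := continuous_const
  haveI := isProbabilityMeasure_localGibbsMeasure (u₀ := fun _ => (0 : V3)) ha hθc hu
    (fun _ => one_pos) (fun _ => hθ) hσ2 N
  have hGm : Measurable fun z : Config (N + 1) (Fin 3) T3 => ENNReal.ofReal (cubicTail N M z) :=
    (measurable_cubicTail N M).ennreal_ofReal
  rw [lintegral_localGibbsMeasure ha hθc hu (fun _ => zero_le_one) (fun _ => hθ) σ N hGm]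
  have hmeas1 : Measurable fun w : V3 => ENNReal.ofReal (tail3 M w) :=
    (measurable_tail3 M).ennreal_ofReal
  -- the inner (velocity) integral is the one-body tail, for every position vector
  have hinner : ∀ x : Fin (N + 1) → T3,
      ∫⁻ v, ENNReal.ofReal (cubicTail N M (zipConfig (x, v))) ∂velMeasure (fun _ => (0 : V3)) (fun _ => θb) x =
        gaussTail θb M := by
    intro x
    have hpt : ∀ v : Fin (N + 1) → V3, ENNReal.ofReal (cubicTail N M (zipConfig (x, v))) =
        ENNReal.ofReal (((N : ℝ) + 1)⁻¹) * ∑ i : Fin (N + 1), ENNReal.ofReal (tail3 M (v i)) := by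
      intro v
      unfold cubicTail
      simp only [zipConfig_apply]
      rw [ENNReal.ofReal_mul (by positivity), ENNReal.ofReal_sum_of_nonneg fun i _ => tail3_nonneg M _]
    have hterm : ∀ i : Fin (N + 1),
        ∫⁻ v, ENNReal.ofReal (tail3 M (v i)) ∂velMeasure (fun _ => (0 : V3)) (fun _ => θb) x =
          gaussTail θb M := by
      intro i
      unfold velMeasure gaussTail
      exact (measurePreserving_eval (fun j : Fin (N + 1) => gaussMeasure ((fun _ : T3 => (0 : V3)) (x j))
        ((fun _ : T3 => θb) (x j))) i).lintegral_comp hmeas1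
    have hsm : Measurable fun v : Fin (N + 1) → V3 =>
        ∑ i : Fin (N + 1), ENNReal.ofReal (tail3 M (v i)) :=
      Finset.measurable_sum _ fun i _ => hmeas1.comp (measurable_pi_apply i)
    have hN : ENNReal.ofReal (((N : ℝ) + 1)⁻¹) * ((N + 1 : ℕ) : ℝ≥0∞) = 1 := by
      rw [ENNReal.ofReal_inv_of_pos (by positivity)]
      have : ENNReal.ofReal ((N : ℝ) + 1) = ((N + 1 : ℕ) : ℝ≥0∞) := by
        rw [show ((N : ℝ) + 1) = ((N + 1 : ℕ) : ℝ) by push_cast; ring, ENNReal.ofReal_natCast]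
      rw [this]
      exact ENNReal.inv_mul_cancel (by simp) (ENNReal.natCast_ne_top _)
    calc ∫⁻ v, ENNReal.ofReal (cubicTail N M (zipConfig (x, v))) ∂velMeasure (fun _ => (0 : V3)) (fun _ => θb) x
        = ∫⁻ v, ENNReal.ofReal (((N : ℝ) + 1)⁻¹) * ∑ i : Fin (N + 1), ENNReal.ofReal (tail3 M (v i))
            ∂velMeasure (fun _ => (0 : V3)) (fun _ => θb) x := lintegral_congr fun v => hpt v
      _ = ENNReal.ofReal (((N : ℝ) + 1)⁻¹) * ∫⁻ v, ∑ i : Fin (N + 1), ENNReal.ofReal (tail3 M (v i))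
            ∂velMeasure (fun _ => (0 : V3)) (fun _ => θb) x := lintegral_const_mul _ hsm
      _ = ENNReal.ofReal (((N : ℝ) + 1)⁻¹) * ∑ i : Fin (N + 1), ∫⁻ v, ENNReal.ofReal (tail3 M (v i))
            ∂velMeasure (fun _ => (0 : V3)) (fun _ => θb) x := by
          congr 1
          exact lintegral_finsetSum _ fun i _ => hmeas1.comp (measurable_pi_apply i)
      _ = ENNReal.ofReal (((N : ℝ) + 1)⁻¹) * ∑ _i : Fin (N + 1), gaussTail θb M := by
          congr 1
          exact Finset.sum_congr rfl fun i _ => hterm i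
      _ = gaussTail θb M := by
          rw [Finset.sum_const, Finset.card_univ, Fintype.card_fin, nsmul_eq_mul, ← mul_assoc, hN,
            one_mul]
  simp_rw [hinner]
  have hfm : Measurable fun x : Fin (N + 1) → T3 => ENNReal.ofReal
      ((canonicalPartition (Torus.geometry (Fin 3)) (hsDiameter σ N) (N + 1)
        (localGibbsProfile (fun _ => 1) (fun _ => 0) (fun _ => θb)))⁻¹ *
          posWeight (fun _ => 1) (hsDiameter σ N) (N + 1) x) :=
    ((measurable_posWeight ha _ _).const_mul _).ennreal_ofReal
  rw [lintegral_mul_const _ hfm, lintegral_posWeight_eq_one ha hθc hu (fun _ => zero_le_one)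
    (fun _ => hθ) σ N, one_mul]

/-- **The one-body Gaussian cubic tail is small for large cut-offs**: `T(M) ≤ M⁻¹ E|w|⁴` for `M > 0`,
and `E|w|⁴ < ∞` (Fernique). -/
theorem gaussTail_le {θb : ℝ} {M : ℝ} (hM : 0 < M) :
    gaussTail θb M ≤ ENNReal.ofReal M⁻¹ * ∫⁻ w, ENNReal.ofReal (‖w‖ ^ 4) ∂(gaussMeasure (0 : V3) θb) := by
  unfold gaussTail
  rw [← lintegral_const_mul _ (measurable_norm.pow_const 4).ennreal_ofReal]
  refine lintegral_mono fun w => ?_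
  rw [← ENNReal.ofReal_mul (inv_nonneg.2 hM.le)]
  refine ENNReal.ofReal_le_ofReal ?_
  unfold tail3
  by_cases hw : M < ‖w‖
  · rw [Set.indicator_of_mem (show w ∈ {v : V3 | M < ‖v‖} from hw)]
    rw [le_inv_mul_iff₀ hM]
    calc M * ‖w‖ ^ 3 ≤ ‖w‖ * ‖w‖ ^ 3 :=
          mul_le_mul_of_nonneg_right hw.le (by positivity)
      _ = ‖w‖ ^ 4 := by ring
  · rw [Set.indicator_of_notMem (show w ∉ {v : V3 | M < ‖v‖} from hw)]
    positivity

theorem lintegral_norm_pow_four_lt_top (θb : ℝ) :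
    ∫⁻ w, ENNReal.ofReal (‖w‖ ^ 4) ∂(gaussMeasure (0 : V3) θb) < ∞ := by
  have h4 : Integrable (fun v : V3 => ‖v‖ ^ 4) (gaussMeasure (0 : V3) θb) :=
    (ProbabilityTheory.IsGaussian.memLp_id _ 4 (by simp)).integrable_norm_pow (by norm_num)
  exact h4.lintegral_lt_top


/-- **`EnergyCurrentTails` at global equilibrium.**  For the homogeneous profile (`a₀ = 1`,
`u₀ = 0`, `θ₀ = θ̄ > 0`), every `0 < σ < 1/2`, every family of hard-sphere flows and every `ε > 0`
there is a cut-off `M` (explicitly `M = E|w|⁴/ε + 1`) such that the crux's expected empirical cubic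
tail is `≤ ε` for ALL `N` and ALL times `s` — the conclusion of the crux in its exact currency, with
no `N₀` and no horizon.  Hence any counterexample to the crux must be genuinely out of equilibrium
and pre-shock. -/
theorem energyCurrentTails_homogeneous {σ θb : ℝ} (hσ : 0 < σ) (hσ2 : σ < 1 / 2) (hθ : 0 < θb)
    (Φ : (N : ℕ) → HardSphereFlow (Torus.geometry (Fin 3)) (hsDiameter σ N) (N + 1))
    {ε : ℝ} (hε : 0 < ε) :
    ∃ M : ℝ, ∀ N : ℕ, ∀ s : ℝ,
      ∫⁻ z, ENNReal.ofReal (((N : ℝ) + 1)⁻¹ * ∑ i : Fin (N + 1),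
          Set.indicator {v : V3 | M < ‖v‖} (fun v => ‖v‖ ^ 3) (((Φ N).flow s z i).2))
        ∂(localGibbsLaw σ (fun _ => 1) (fun _ => 0) (fun _ => θb) N (Φ N)) ≤ ENNReal.ofReal ε := by
  set C4 : ℝ≥0∞ := ∫⁻ w, ENNReal.ofReal (‖w‖ ^ 4) ∂(gaussMeasure (0 : V3) θb) with hC4
  have hC4top : C4 ≠ ⊤ := (lintegral_norm_pow_four_lt_top θb).ne
  refine ⟨C4.toReal / ε + 1, fun N s => ?_⟩
  have hC4r : 0 ≤ C4.toReal := ENNReal.toReal_nonneg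
  have hM : 0 < C4.toReal / ε + 1 := by positivity
  rw [localGibbsLaw_eq]
  have hF : Measurable fun z : Config (N + 1) (Fin 3) T3 =>
      ENNReal.ofReal (cubicTail N (C4.toReal / ε + 1) z) :=
    (measurable_cubicTail N _).ennreal_ofReal
  have h1 := lintegral_comp_flow_eq hσ hσ2 θb N (Φ N) s hF
  show ∫⁻ z, ENNReal.ofReal (cubicTail N (C4.toReal / ε + 1) ((Φ N).flow s z))
      ∂(localGibbsMeasure σ (fun _ => 1) (fun _ => 0) (fun _ => θb) N) ≤ ENNReal.ofReal ε
  rw [h1, lintegral_cubicTail_eq_gaussTail hσ2.le hθ N]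
  calc gaussTail θb (C4.toReal / ε + 1)
      ≤ ENNReal.ofReal (C4.toReal / ε + 1)⁻¹ * C4 := gaussTail_le hM
    _ = ENNReal.ofReal ((C4.toReal / ε + 1)⁻¹ * C4.toReal) := by
        rw [ENNReal.ofReal_mul (inv_nonneg.2 hM.le), ENNReal.ofReal_toReal hC4top]
    _ ≤ ENNReal.ofReal ε := by
        refine ENNReal.ofReal_le_ofReal ?_
        rw [inv_mul_le_iff₀ hM, add_mul, div_mul_cancel₀ _ hε.ne']
        linarith


/-- **The crux's body, verbatim, at the homogeneous profile** `(a₀, u₀, θ₀) = (1, 0, θ̄)`: what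
`EnergyCurrentTails` asserts after its five profile hypotheses, with `σ₀ = 1/2`, `N₀ = 0`, the Euler
solution and the LLN hypothesis unused (they only bound the horizon). -/
theorem energyCurrentTails_body_homogeneous {θb : ℝ} (hθ : 0 < θb) :
    ∃ σ₀ : ℝ, 0 < σ₀ ∧ ∀ σ : ℝ, 0 < σ → σ < σ₀ →
      ∀ (T : ℝ) (ρ θ : ℝ → T3 → ℝ) (u : ℝ → T3 → V3), IsHardSphereEulerSolution σ T ρ u θ →
        ∀ Φ : (N : ℕ) → HardSphereFlow (Torus.geometry (Fin 3)) (hsDiameter σ N) (N + 1),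
          TendstoHydroFieldsAt (fun N => localGibbsLaw σ (fun _ => 1) (fun _ => 0) (fun _ => θb) N (Φ N))
              Φ ρ u θ 0 →
            ∀ t ∈ Set.Ico 0 T, ∀ ε : ℝ, 0 < ε → ∃ M : ℝ, ∃ N₀ : ℕ, ∀ N : ℕ, N₀ ≤ N →
              ∀ s ∈ Set.Icc 0 t,
                ∫⁻ z, ENNReal.ofReal (((N : ℝ) + 1)⁻¹ * ∑ i : Fin (N + 1),
                    Set.indicator {v : V3 | M < ‖v‖} (fun v => ‖v‖ ^ 3) (((Φ N).flow s z i).2))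
                  ∂(localGibbsLaw σ (fun _ => 1) (fun _ => 0) (fun _ => θb) N (Φ N)) ≤
                  ENNReal.ofReal ε := by
  refine ⟨1 / 2, by norm_num, fun σ hσ hσ2 T ρ θ u _ Φ _ t _ ε hε => ?_⟩
  obtain ⟨M, hM⟩ := energyCurrentTails_homogeneous hσ hσ2 hθ Φ hε
  exact ⟨M, 0, fun N _ s _ => hM N s⟩


/-! ### Constant activity: the homogeneous law does not depend on the value of the activity -/

/-- Scaling the one-particle profile by a non-zero constant does not change the canonical density
(the factor `a^n` cancels against the partition function; junk values match). -/
theorem canonicalDensity_const_mul {d : Type*} [Fintype d] {X : Type*} [MeasureSpace X]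
    (G : Geometry d X) (ε : ℝ) (n : ℕ) (f : X × EuclideanSpace ℝ d → ℝ) {a : ℝ} (ha : a ≠ 0) :
    canonicalDensity G ε n (fun y => a * f y) = canonicalDensity G ε n f := by
  funext z
  have htp : ∀ w : Config n d X, tensorPow n (fun y => a * f y) w = a ^ n * tensorPow n f w := by
    intro w
    unfold tensorPow
    rw [Finset.prod_mul_distrib, Finset.prod_const, Finset.card_univ, Fintype.card_fin]
  have hind : ∀ w : Config n d X, (hardSphereDomain G n ε).indicator (tensorPow n fun y => a * f y) w =
      a ^ n * (hardSphereDomain G n ε).indicator (tensorPow n f) w := by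
    intro w
    by_cases hw : w ∈ hardSphereDomain G n ε
    · rw [Set.indicator_of_mem hw, Set.indicator_of_mem hw, htp]
    · rw [Set.indicator_of_notMem hw, Set.indicator_of_notMem hw, mul_zero]
  have hZ : canonicalPartition G ε n (fun y => a * f y) = a ^ n * canonicalPartition G ε n f := by
    unfold canonicalPartition
    simp_rw [hind]
    exact integral_const_mul _ _
  unfold canonicalDensity
  rw [hZ, hind, mul_inv]
  have han : a ^ n ≠ 0 := pow_ne_zero n ha
  field_simp

/-- The local Gibbs measure with constant activity `a ≠ 0` equals the one with activity `1`. -/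
theorem localGibbsMeasure_const_activity (σ : ℝ) {a : ℝ} (ha : a ≠ 0) (u₀ : T3 → V3)
    (θ₀ : T3 → ℝ) (N : ℕ) :
    localGibbsMeasure σ (fun _ => a) u₀ θ₀ N = localGibbsMeasure σ (fun _ => 1) u₀ θ₀ N := by
  unfold localGibbsMeasure
  have hprof : localGibbsProfile (fun _ => a) u₀ θ₀ = fun y => a * localGibbsProfile (fun _ => 1) u₀ θ₀ y := by
    funext y
    simp [localGibbsProfile]
  rw [hprof, canonicalDensity_const_mul _ _ _ _ ha]

/-- `energyCurrentTails_homogeneous` for every constant activity `a > 0`. -/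
theorem energyCurrentTails_homogeneous' {σ θb a : ℝ} (hσ : 0 < σ) (hσ2 : σ < 1 / 2) (hθ : 0 < θb)
    (ha : 0 < a)
    (Φ : (N : ℕ) → HardSphereFlow (Torus.geometry (Fin 3)) (hsDiameter σ N) (N + 1))
    {ε : ℝ} (hε : 0 < ε) :
    ∃ M : ℝ, ∀ N : ℕ, ∀ s : ℝ,
      ∫⁻ z, ENNReal.ofReal (((N : ℝ) + 1)⁻¹ * ∑ i : Fin (N + 1),
          Set.indicator {v : V3 | M < ‖v‖} (fun v => ‖v‖ ^ 3) (((Φ N).flow s z i).2))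
        ∂(localGibbsLaw σ (fun _ => a) (fun _ => 0) (fun _ => θb) N (Φ N)) ≤ ENNReal.ofReal ε := by
  obtain ⟨M, hM⟩ := energyCurrentTails_homogeneous hσ hσ2 hθ Φ hε
  refine ⟨M, fun N s => ?_⟩
  have h := hM N s
  rw [localGibbsLaw_eq] at h ⊢
  rw [localGibbsMeasure_const_activity σ ha.ne']
  exact h

end Summit.AtomisticToContinuum.HydrodynamicLimit.Cruxes.EnergyCurrentTails.Equilibrium

end
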